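import Mathlib
import Summits.ResolutionOfSingularities.ResolutionOfSingularities.Theses.SyzygyFlattening
import Summits.ResolutionOfSingularities.ResolutionOfSingularities.Theorems.SyzygyFlatteningDefs
import Summits.ResolutionOfSingularities.ResolutionOfSingularities.Theorems.SyzygyFlatteningHigherRankTerminationRankLeOneDimZero
import Summits.ResolutionOfSingularities.ResolutionOfSingularities.Theorems.SyzygyFlatteningHigherRankTerminationTowerLocalisation
import Literature.AlgebraicGeometry.Resolution.CompositeValuations
import Literature.AlgebraicGeometry.Resolution.RegularLocalRingsProofs
import HarnessLib

/-!
# `HigherRankTermination` reduced to its two open cores (crux stmt-ResolutionOfSingularities-17045)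

Route `ResolutionOfSingularities/SyzygyFlattening`, crux #3 `HigherRankTermination`
("`RankOneTermination` at `p` ⇒ the syzygy-flattening tower terminates along every
dimension-zero valuation"), line `birth`, lead prover.

With the line's infrastructure landed (the operator commutes with coarsening:
`towerLocalisation`; regular stages are terminal: `tower_eq_of_regular`; the rank ≤ 1,
dimension-zero case: `stub_rankLeOneDimZero`), the crux is EQUIVALENT — kernel-checked below,
`stub_cruxReduction` — to the conjunction, under the same hypothesis `RankOneInput p`, of its two
registered open stubs:

* **positive-dimensional rank one** (`stub_posDimRankOne`, route-review objection O1): the tower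
  terminates along the rank-one coarsening `O₁` (`O < O₁ < K`, two overrings) of a
  dimension-zero valuation ring `O` — a rank-one valuation of POSITIVE dimension, to which
  `RankOneInput p` (rank one AND dimension zero, index `n = tr.deg_k K`) does not apply; this is
  crux #2 `RankOneTermination` restated without its dimension-zero binder, at the ambient index;
* **residual steering** (`stub_residualSteering`, the crux's named mechanism): for dimension-zero
  `O` and a proper coarsening `O < O₁ < K`, eventual persistent regularity of the `O`-tower at the
  centre of `O₁` ⇒ termination along `O`.

The forward implications are: termination along `O` ⇒ termination along every coarsening
`O₁ ⊇ O` (`towerTerminates_of_le`: a regular stage localised at the centre of `ν₁` is regular —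
Serre — and that localisation IS the stage of the `O₁`-tower, `towerLocalisation`), and
trivially for the second core. The backward implication is the line's composition (largest
proper overring via `finite_overrings_of_fg`; `eventuallyRegularAlong_of_towerTerminates`).
So objection O1 is not an artefact of the line `birth`: EVERY proof of the crux proves
`stub_posDimRankOne`.

References: Novacoski–Spivakovsky 2014 (Thm. 1.1, the shape of the induction on the rank);
Zariski–Samuel II, VI §10 (rank and composite valuations).
-/

noncomputable section

-- single-problem summit: the doubled namespace component `ResolutionOfSingularities` is forced
set_option linter.dupNamespace false

open Literature.AlgebraicGeometry.Resolution (finite_overrings_of_fg)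
open Summit.ResolutionOfSingularities.ResolutionOfSingularities.Theses.SyzygyFlattening
  (HigherRankTermination)

namespace Summit.ResolutionOfSingularities.ResolutionOfSingularities.Theorems.SyzygyFlattening

variable {k K : Type} [Field k] [Field K] [Algebra k K]

/-- **Termination passes to coarsenings.** If the tower along `O` reaches a regular local ring,
so does the tower along every coarsening `O₁ ⊇ O`: the stage of the `O₁`-tower is the stage of
the `O`-tower localised at the centre of `ν₁` (`towerLocalisation`), and a localisation of a
regular local ring at a prime is regular (Serre, tree `isRegularLocalRing_localization_atPrime`).
[cite: NovacoskiSpivakovsky2014, Lemma 2.5 (1)] -/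
theorem towerTerminates_of_le (O O₁ : ValuationSubring K) (A : Subalgebra k K)
    (hk : ∀ c : k, algebraMap k K c ∈ O) (hFG : A.FG) (hFrac : IsFractionRing ↥A K)
    (hAO : A.toSubring ≤ O.toSubring) (hOO₁ : O ≤ O₁) (h : TowerTerminates O A) :
    TowerTerminates O₁ A := by
  obtain ⟨m, hreg⟩ := h
  refine ⟨m, ?_⟩
  rw [← towerLocalisation O A hk hFG hFrac hAO O₁ hOO₁ m]
  have hT : (tower O A m).toSubring ≤ O₁.toSubring :=
    fun y hy => hOO₁ (tower_toSubring_le O hk hAO m hy)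
  rw [isRegularLocalRing_locAt_iff_atPrime O₁ (tower O A m) hT]
  haveI : IsRegularLocalRing ↥((tower O A m).toSubring) := hreg
  exact Literature.AlgebraicGeometry.Resolution.isRegularLocalRing_localization_atPrime _ _

/-- **Registered glue stub `stub_cruxReduction`: the crux is its two open cores.**
`HigherRankTermination` holds iff, for every prime `p`, `RankOneInput p` implies BOTH
(i) termination along the rank-one coarsening of every dimension-zero valuation ring of rank
≥ 2 (the statement of `stub_posDimRankOne`) AND (ii) residual steering (the statement of
`stub_residualSteering`). (→): (i) by `towerTerminates_of_le`, (ii) by weakening. (←): the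
two-overring case is `stub_rankLeOneDimZero`; otherwise the largest proper overring `O₁`
(finitely many: `finite_overrings_of_fg`) is the rank-one coarsening, (i) gives termination along
it, `eventuallyRegularAlong_of_towerTerminates` transports it to the `O`-tower, (ii) finishes.
[cite: NovacoskiSpivakovsky2014, Thm. 1.1 (shape of the induction)] -/
theorem stub_cruxReduction : HigherRankTermination ↔
    ∀ (p : ℕ), p.Prime → RankOneInput p →
      (∀ (k K : Type) [Field k] [CharP k p] [Field K] [Algebra k K] (O : ValuationSubring K)
        (A : Subalgebra k K), (∀ c : k, algebraMap k K c ∈ O) → A.FG → IsFractionRing ↥A K →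
        A.toSubring ≤ O.toSubring → DimZero k O →
        ∀ O₁ : ValuationSubring K, O < O₁ → O₁ ≠ ⊤ → TwoOverrings O₁ → TowerTerminates O₁ A) ∧
      (∀ (k K : Type) [Field k] [CharP k p] [Field K] [Algebra k K] (O : ValuationSubring K)
        (A : Subalgebra k K), (∀ c : k, algebraMap k K c ∈ O) → A.FG → IsFractionRing ↥A K →
        A.toSubring ≤ O.toSubring → DimZero k O →
        ∀ O₁ : ValuationSubring K, O < O₁ → O₁ ≠ ⊤ → EventuallyRegularAlong O A O₁ →
        TowerTerminates O A) := by
  constructor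
  · intro hHR p hp hR1
    have hHR' := (higherRankTermination_iff.mp hHR) p hp hR1
    refine ⟨?_, ?_⟩
    · intro k K _ _ _ _ O A hk hFG hFrac hAO halg O₁ hlt _ _
      exact towerTerminates_of_le O O₁ A hk hFG hFrac hAO hlt.le
        (hHR' k K O A hk hFG hFrac hAO halg)
    · intro k K _ _ _ _ O A hk hFG hFrac hAO halg _ _ _ _
      exact hHR' k K O A hk hFG hFrac hAO halg
  · intro h
    refine higherRankTermination_iff.mpr fun p hp hR1 k K _ _ _ _ O A hk hFG hFrac hAO halg => ?_
    obtain ⟨hPD, hRS⟩ := h p hp hR1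
    -- two-overring case (trivial valuation or rank one): the landed base stub
    by_cases h2 : TwoOverrings O
    · exact stub_rankLeOneDimZero p hp hR1 k K O A hk hFG hFrac hAO halg h2
    -- otherwise pick the largest proper overring `O₁` of `O` (finitely many overrings)
    haveI : IsFractionRing ↥A K := hFrac
    have hfin : Finite {S : ValuationSubring K // O ≤ S} := finite_overrings_of_fg O hk A hFG
    have hTfin : ({S : ValuationSubring K | O ≤ S ∧ S ≠ ⊤} : Set (ValuationSubring K)).Finite := by
      have h1 : ({S : ValuationSubring K | O ≤ S} : Set (ValuationSubring K)).Finite :=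
        Set.finite_coe_iff.mp hfin
      exact h1.subset fun S hS => hS.1
    have hOtop : O ≠ ⊤ := by
      intro hO
      apply h2
      intro S hS
      exact Or.inr (top_le_iff.mp (hO ▸ hS))
    have hTne : ({S : ValuationSubring K | O ≤ S ∧ S ≠ ⊤} : Set (ValuationSubring K)).Nonempty :=
      ⟨O, le_rfl, hOtop⟩
    obtain ⟨O₁, hO₁⟩ := hTfin.exists_maximal hTne
    have hOO₁ : O ≤ O₁ := hO₁.1.1
    have hO₁top : O₁ ≠ ⊤ := hO₁.1.2
    have h2' : TwoOverrings O₁ := by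
      intro S hS
      by_cases hSt : S = ⊤
      · exact Or.inr hSt
      · exact Or.inl (le_antisymm (hO₁.2 ⟨hOO₁.trans hS, hSt⟩ hS) hS)
    have hne : O ≠ O₁ := by
      intro hOeq
      apply h2
      intro S hS
      rcases h2' S (hOeq ▸ hS) with h | h
      · exact Or.inl (h.trans hOeq.symm)
      · exact Or.inr h
    have hlt : O < O₁ := lt_of_le_of_ne hOO₁ hne
    have hterm₁ : TowerTerminates O₁ A :=
      hPD k K O A hk hFG hFrac hAO halg O₁ hlt hO₁top h2'
    have hev : EventuallyRegularAlong O A O₁ :=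
      eventuallyRegularAlong_of_towerTerminates O A hk hFG hFrac hAO O₁ hOO₁ hterm₁
    exact hRS k K O A hk hFG hFrac hAO halg O₁ hlt hO₁top hev

end Summit.ResolutionOfSingularities.ResolutionOfSingularities.Theorems.SyzygyFlattening

end
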